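import Literature.Probability.Percolation.KozmaNitzanPreFKG
import HarnessLib

/-! # Crux `PercNearOneGluing.AdditiveGluing` (stmt-CriticalPhenomena-4576) — transport with a NON-PRINCIPAL decreasing cluster event
# (tool for the two-port KERNEL certificate; seat (b) V⁺-form, depth prover `png-dp-vplus`, gen 8)

Support file (`--supports stmt-CriticalPhenomena-4576`); no definitions, no named facts, no sorries.

Kozma–Nitzan's Lemma 3(ii) transports `μ(a₁ ↔ b, Q) ≤ μ(a₂ ↔ b, Q)` for every decreasing event `Q` of the open cluster of `a₁` whenever
`μ(a₁↔b) ≤ μ(a₂↔b)`.  The tree's ready-made instance (`KozmaNitzan2024_lemma3_ii_notConn`) covers the PRINCIPAL events `Q = {C(a₁) ∩ S = ∅}`.  The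
machine-found certificate proving the two-port KERNEL of the finger-stripping programme (memo MEMO-gen8 §11–§12 of
run/shared/lean/prim/prim-png-dp-vplus/: for a hub `ν` with ports `c₁, c₂` and a vertex `c*`, `μ(E_x) ≥ min(τ(c₁), τ(c₂), τ(c*))` for every spy `x`) needs
exactly one non-principal instance, the decreasing event

  `Q = {c ∉ C(a₁)} ∩ ¬({x ∈ C(a₁)} ∧ {y ∈ C(a₁)})`      ("`a₁` is cut from `c`, and not joined to both `x` and `y`"),

which with `y := ν` lets one transport act differently on the hair patterns of `ν`.  This file lands that instance (`lemma3_ii_notConn_notBoth`) and, for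
convenience, the union form `Q = {c ∉ C(a₁)} ∩ ({x ∉ C(a₁)} ∪ {y ∉ C(a₁)})` (`lemma3_ii_notConn_notConnOr`), both as direct corollaries of
`KozmaNitzan2024_lemma3_ii` with the lower family `disconnFamily a₁ {c} ∩ (connFamily a₁ x ∩ connFamily a₁ y)ᶜ`.
[cite: KozmaNitzan2024, Lemma 3(ii) (pp. 6–7)]
-/

namespace Summit.CriticalPhenomena.PercolationContinuityZ3.Theorems

open MeasureTheory Set
open Literature.Probability.LatticeModels (prodBernoulli)
open Literature.Probability.Percolation

noncomputable section
open Classical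

section KernelTools

variable {V : Type*} [Fintype V]

omit [Fintype V] in
/-- The event "`a` is cut from `c` and not joined to both `x` and `y`" is the event that the open edge cluster of `a` lies in the lower family
`disconnFamily a {c} ∩ (connFamily a x ∩ connFamily a y)ᶜ`. [folklore] -/
theorem setOf_notConn_notBoth_eq (a c x y : V) :
    ({ω : BondConfig V | ¬ (openGraph ω).Reachable a c} ∩ {ω | ¬ ((openGraph ω).Reachable a x ∧ (openGraph ω).Reachable a y)}) =
      {ω | openEdgeCluster ω a ∈
        KNPreFKG.disconnFamily a ({c} : Set V) ∩ (KNPreFKG.connFamily a x ∩ KNPreFKG.connFamily a y)ᶜ} := by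
  ext ω
  simp only [Set.mem_inter_iff, Set.mem_setOf_eq, Set.mem_compl_iff, KNPreFKG.disconnFamily, KNPreFKG.connFamily,
    Set.mem_singleton_iff, forall_eq, reachable_iff_exists_mem_openEdgeCluster]

omit [Fintype V] in
/-- That family is a lower family (a decreasing event of the cluster of `a`). [folklore] -/
theorem isLowerSet_notConn_notBoth (a c x y : V) :
    IsLowerSet (KNPreFKG.disconnFamily a ({c} : Set V) ∩ (KNPreFKG.connFamily a x ∩ KNPreFKG.connFamily a y)ᶜ :
      Set (Set (Sym2 V))) :=
  (KNPreFKG.isLowerSet_disconnFamily a {c}).inter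
    ((KNPreFKG.isUpperSet_connFamily a x).inter (KNPreFKG.isUpperSet_connFamily a y)).compl

/-- **Lemma 3(ii) with the non-principal event `{c ∉ C(a₁)} ∩ ¬({x ∈ C(a₁)} ∧ {y ∈ C(a₁)})`.**  If `μ(a₁↔b) ≤ μ(a₂↔b)` then
`μ(a₁↔b, a₁↮c, ¬(a₁↔x ∧ a₁↔y)) ≤ μ(a₂↔b, a₁↮c, ¬(a₁↔x ∧ a₁↔y))`.  (The transport `T_a` of the two-port KERNEL certificate, with
`(a₁, a₂, c, x, y) := (c₁, c*, c*, x, ν)`.) [cite: KozmaNitzan2024, Lemma 3(ii) (pp. 6–7)] -/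
theorem lemma3_ii_notConn_notBoth (w : Sym2 V → unitInterval) (a₁ a₂ b c x y : V)
    (h : (prodBernoulli w).real (openConn a₁ b) ≤ (prodBernoulli w).real (openConn a₂ b)) :
    (prodBernoulli w).real (openConn a₁ b ∩
        ({ω : BondConfig V | ¬ (openGraph ω).Reachable a₁ c} ∩ {ω | ¬ ((openGraph ω).Reachable a₁ x ∧ (openGraph ω).Reachable a₁ y)})) ≤
      (prodBernoulli w).real (openConn a₂ b ∩
        ({ω : BondConfig V | ¬ (openGraph ω).Reachable a₁ c} ∩ {ω | ¬ ((openGraph ω).Reachable a₁ x ∧ (openGraph ω).Reachable a₁ y)})) := by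
  have key := KozmaNitzan2024_lemma3_ii w a₁ a₂ b le_rfl (by simpa using h) (isLowerSet_notConn_notBoth a₁ c x y)
  rw [← setOf_notConn_notBoth_eq, add_zero] at key
  exact key

omit [Fintype V] in
/-- The event "`a` is cut from `c`, and cut from `x` or from `y`" as a cluster event: the lower family
`disconnFamily a {c} ∩ (disconnFamily a {x} ∪ disconnFamily a {y})`. [folklore] -/
theorem setOf_notConn_notConnOr_eq (a c x y : V) :
    ({ω : BondConfig V | ¬ (openGraph ω).Reachable a c} ∩ {ω | ¬ (openGraph ω).Reachable a x ∨ ¬ (openGraph ω).Reachable a y}) =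
      {ω | openEdgeCluster ω a ∈
        KNPreFKG.disconnFamily a ({c} : Set V) ∩ (KNPreFKG.disconnFamily a ({x} : Set V) ∪ KNPreFKG.disconnFamily a ({y} : Set V))} := by
  ext ω
  simp only [Set.mem_inter_iff, Set.mem_setOf_eq, Set.mem_union, KNPreFKG.disconnFamily, Set.mem_singleton_iff, forall_eq,
    reachable_iff_exists_mem_openEdgeCluster]

omit [Fintype V] in
/-- That family is a lower family. [folklore] -/
theorem isLowerSet_notConn_notConnOr (a c x y : V) :
    IsLowerSet (KNPreFKG.disconnFamily a ({c} : Set V) ∩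
      (KNPreFKG.disconnFamily a ({x} : Set V) ∪ KNPreFKG.disconnFamily a ({y} : Set V)) : Set (Set (Sym2 V))) :=
  (KNPreFKG.isLowerSet_disconnFamily a {c}).inter
    ((KNPreFKG.isLowerSet_disconnFamily a {x}).union (KNPreFKG.isLowerSet_disconnFamily a {y}))

/-- **Lemma 3(ii) with the event `{c ∉ C(a₁)} ∩ ({x ∉ C(a₁)} ∪ {y ∉ C(a₁)})`.**  If `μ(a₁↔b) ≤ μ(a₂↔b)` then
`μ(a₁↔b, a₁↮c, a₁↮x ∨ a₁↮y) ≤ μ(a₂↔b, a₁↮c, a₁↮x ∨ a₁↮y)`.  (The variants `T_b`, `T_c` of the certificate are of this shape.)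
[cite: KozmaNitzan2024, Lemma 3(ii) (pp. 6–7)] -/
theorem lemma3_ii_notConn_notConnOr (w : Sym2 V → unitInterval) (a₁ a₂ b c x y : V)
    (h : (prodBernoulli w).real (openConn a₁ b) ≤ (prodBernoulli w).real (openConn a₂ b)) :
    (prodBernoulli w).real (openConn a₁ b ∩
        ({ω : BondConfig V | ¬ (openGraph ω).Reachable a₁ c} ∩ {ω | ¬ (openGraph ω).Reachable a₁ x ∨ ¬ (openGraph ω).Reachable a₁ y})) ≤
      (prodBernoulli w).real (openConn a₂ b ∩
        ({ω : BondConfig V | ¬ (openGraph ω).Reachable a₁ c} ∩ {ω | ¬ (openGraph ω).Reachable a₁ x ∨ ¬ (openGraph ω).Reachable a₁ y})) := by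
  have key := KozmaNitzan2024_lemma3_ii w a₁ a₂ b le_rfl (by simpa using h) (isLowerSet_notConn_notConnOr a₁ c x y)
  rw [← setOf_notConn_notConnOr_eq, add_zero] at key
  exact key

end KernelTools

end

end Summit.CriticalPhenomena.PercolationContinuityZ3.Theorems
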